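import Literature.AlgebraicGeometry.Motives.HodgeThetaSubalgebraUnitaryProfileFourSix
import HarnessLib

/-!
# TOOL G in general form: the orthogonal-chain count at a minimal raising operator with constant Levi profile

Family `hodge`, layer `Literature/AlgebraicGeometry/Motives` (pure linear algebra over `ℂ`; no geometry). Research
context: cell `pub-hodge-ring2` (HONEST FRAMING: research route conditional on HC_CM; not a corollary; Q11.4-sentence-2
already refuted in dim ≥ 3), Literature lane gen 88. UNCONDITIONAL; theorems only, no definition, no named fact
(D-0026), no `sorry`. This file restates `UnitaryProfileFourSix.false_of_profile` (`HodgeThetaSubalgebraUnitaryProfileFourSix`,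
the `(4, 6)` case of the `(15 | 22)` cell of Ribet's theorem) with the dimensions as parameters, for use in further
cells of Ribet 1983 Thm. 3 (first use: the `(8 | 35)` cell at minimal rank `7`, profile `(1, 6)`).

THE STATEMENT (`UnitaryOrthogonalChain.false_of_constProfile`). Setting of `UnitaryProfileFourSix.member`: `𝔊`
bracket-closed, `Θ` an involution (`P`, `Q`), Hermitian data, `𝔊` adjoint-closed, `B ∈ 𝔊` raising of MINIMAL non-zero
rank with involution `ι` and pieces `P ∩ U⁺`, `Q ∩ U⁺`, `B(W)`, `Q ∩ ker B`. HYPOTHESES: every non-zero raising `X ∈ 𝔊`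
commuting with `ι` has the same profile `(i, j)`, `i < j`, `i + j = rk B`; `c = dim (P ∩ U⁺) − i`; counting functions
`g, G : ℕ → ℕ` with `dim (Q ∩ U⁺) ≤ g 0`, `G 0 = 0`, `g t ≤ g (t+1) + (dim (P ∩ U⁺) ∸ (t+1)c)`, `G t + g (t+1) ≤ G (t+1)`,
`G t < dim (Q ∩ ker B)` for all `t`; and no non-zero vector of `Q ∩ ker B` is killed by all such `X` (irreducibility
of `L⁻`, supplied by the caller). CONCLUSION: `False`.

THE ARGUMENT is that of `HodgeThetaSubalgebraUnitaryProfileFourSix` verbatim: along an orthogonal family `X_1, …, X_t`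
(slot constants `λ(X_a, X_b) = 0`), `N_t = Q ∩ U⁺ ∩ ⋂ ker X_a` satisfies `n_t ≤ g t` (each `X_a(U⁺)` has codimension
`c` in `P ∩ U⁺`, and `X_t` maps `N_{t−1}` onto a space containing `P ∩ U⁺ ∩ ⋂_{a ≤ t} X_a(U⁺)`), and
`K_t = Q ∩ ker B ∩ ⋂ ker X_a` loses at most `n_t` dimensions at step `t` (`X_t(K_{t−1}) ⊆ ⋂_{a≤t} X_a(U⁻) ⊆ B(N_t)`);
a maximal orthogonal family spans the raising elements commuting with `ι`, so `K_t ≠ 0` is killed by all of them.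
[cite: Ribet1983, Thm. 3] [cite: Gordon1997, Thm. 6.3 (3)] [cite: GoodmanWallachGTM255, §2.3.1, §4.1.1]
[cite: HoffmanKunze1971LinearAlgebra, §8.5, §6.7, §3.1 Thm. 2] [cite: Deligne1982HodgeCycles, I §3 Prop. 3.4, 3.6]

## References
* [Ribet1983] K. A. Ribet, *Hodge classes on certain types of abelian varieties*, Amer. J. Math. 105 (1983), Thm. 3.
* [Gordon1997] B. B. Gordon, *A survey of the Hodge conjecture for abelian varieties*, Thm. 6.3 (3), pp. 18–19.
* [GoodmanWallachGTM255] R. Goodman, N. R. Wallach, GTM 255 (2009), §2.3.1, §4.1.1.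
* [HoffmanKunze1971LinearAlgebra] K. Hoffman, R. Kunze, *Linear Algebra* (1971), §3.1 Thm. 2, §6.7, §8.5.
* [Deligne1982HodgeCycles] P. Deligne, *Hodge cycles on abelian varieties*, LNM 900 (1982), I §3 Prop. 3.4, 3.6.
-/

noncomputable section

open Module

namespace Literature.AlgebraicGeometry.Motives

namespace HodgeStructure

universe u

variable {W : Type u} [AddCommGroup W] [Module ℂ W]

/-! ### §1 A lattice helper -/

/-- `⨅` over `Fin (t+1)` of a family extended by `Fin.snoc`, composed with any map into a complete lattice.
[folklore] -/
private theorem UnitaryOrthogonalChain.iInf_comp_snoc {α β : Type*} [CompleteLattice β] {t : ℕ} (f : α → β) (X : Fin t → α)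
    (y : α) : (⨅ a, f ((Fin.snoc X y : Fin (t + 1) → α) a)) = (⨅ a, f (X a)) ⊓ f y := by
  apply le_antisymm
  · refine le_inf (le_iInf fun a => ?_) ?_
    · simpa using iInf_le (fun a => f ((Fin.snoc X y : Fin (t + 1) → α) a)) a.castSucc
    · simpa using iInf_le (fun a => f ((Fin.snoc X y : Fin (t + 1) → α) a)) (Fin.last t)
  · refine le_iInf fun a => ?_
    refine Fin.lastCases ?_ (fun a => ?_) a
    · simp
    · simpa using inf_le_left.trans (iInf_le (fun a => f (X a)) a)

/-! ### §2 The theorem -/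

/-- **TOOL G — the orthogonal-chain count, general form.** At a raising `B ∈ 𝔊` of minimal rank with Levi data, a
CONSTANT profile `(i, j)` (`i < j`, `i + j = rk B`) of the non-zero raising elements commuting with `ι` is impossible
as soon as counting functions `g, G : ℕ → ℕ` witness `n_t ≤ g t`, `Σ_{s ≤ t} g s ≤ G t < dim (Q ∩ ker B)` for the
recursion `n₀ = dim (Q ∩ U⁺)`, `n_{t+1} ≤ n_t − max(0, dim (P ∩ U⁺) − (t+1)·c)`, `c = dim (P ∩ U⁺) − i` — given that no
non-zero vector of `Q ∩ ker B` is killed by all such elements. See the module docstring.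
[cite: Ribet1983, Thm. 3] [cite: Gordon1997, Thm. 6.3 (3)] [cite: GoodmanWallachGTM255, §2.3.1, §4.1.1]
[cite: HoffmanKunze1971LinearAlgebra, §8.5, §3.1 Thm. 2] [cite: Deligne1982HodgeCycles, I §3 Prop. 3.4, 3.6] -/
theorem UnitaryOrthogonalChain.false_of_constProfile [FiniteDimensional ℂ W] {𝔊 : Submodule ℂ (Module.End ℂ W)}
    (hbr : ∀ Y ∈ 𝔊, ∀ Z ∈ 𝔊, Y * Z - Z * Y ∈ 𝔊) {Θ : Module.End ℂ W} (hΘΘ : Θ * Θ = 1)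
    {P Q : Submodule ℂ W} (hP : ∀ x, x ∈ P ↔ Θ x = x) (hQ : ∀ x, x ∈ Q ↔ Θ x = -x)
    {s : W → W → ℂ} (hadd : ∀ x y z, s (x + y) z = s x z + s y z)
    (hsmul : ∀ (c : ℂ) (x y : W), s (c • x) y = c * s x y) (hsymm : ∀ x y, s y x = starRingEnd ℂ (s x y))
    (hPQ : ∀ p ∈ P, ∀ q ∈ Q, s p q = 0) (hdefP : ∀ p ∈ P, s p p = 0 → p = 0) (hdefQ : ∀ q ∈ Q, s q q = 0 → q = 0)
    (hadj : ∀ X ∈ 𝔊, ∃ Y ∈ 𝔊, ∀ x y, s (X x) y = s x (Y y))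
    {B : Module.End ℂ W} (hB : B ∈ 𝔊) (hΘB : Θ * B = B) (hBΘ : B * Θ = -B)
    (hmin : ∀ Z ∈ 𝔊, Θ * Z = Z → Z * Θ = -Z → Z ≠ 0 →
      Module.finrank ℂ (LinearMap.range B) ≤ Module.finrank ℂ (LinearMap.range Z))
    {ι : Module.End ℂ W} {Um Up PU QU : Submodule ℂ W} (hιι : ι * ι = 1) (hιΘ : ι * Θ = Θ * ι)
    (hιs : ∀ x y, s (ι x) y = s x (ι y)) (hUm : ∀ x, x ∈ Um ↔ ι x = -x) (hUp : ∀ x, x ∈ Up ↔ ι x = x)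
    (hPM : ∀ x, x ∈ LinearMap.range B ↔ ι x = -x ∧ Θ x = x)
    (hQM : ∀ x, x ∈ Q ⊓ LinearMap.ker B ↔ ι x = -x ∧ Θ x = -x)
    (hPU : ∀ x, x ∈ PU ↔ ι x = x ∧ Θ x = x) (hQU : ∀ x, x ∈ QU ↔ ι x = x ∧ Θ x = -x)
    (hfinQU' : Module.finrank ℂ QU = Module.finrank ℂ (LinearMap.range B))
    {i j c : ℕ} (hprof : ∀ X ∈ 𝔊, Θ * X = X → X * Θ = -X → X * ι = ι * X → X ≠ 0 →
      Module.finrank ℂ (Up.map X) = i ∧ Module.finrank ℂ (Um.map X) = j)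
    (hij : i < j) (hsumij : i + j = Module.finrank ℂ (LinearMap.range B)) (hic : i + c = Module.finrank ℂ PU)
    (g G : ℕ → ℕ) (hg0 : Module.finrank ℂ QU ≤ g 0) (hG0 : G 0 = 0)
    (hg : ∀ t, g t ≤ g (t + 1) + (Module.finrank ℂ PU - (t + 1) * c)) (hG : ∀ t, G t + g (t + 1) ≤ G (t + 1))
    (hGlt : ∀ t, G t < Module.finrank ℂ ↥(Q ⊓ LinearMap.ker B))
    (hjoint : ∀ q ∈ Q ⊓ LinearMap.ker B,
      (∀ X ∈ 𝔊, Θ * X = X → X * Θ = -X → X * ι = ι * X → X q = 0) → q = 0) : False := by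
  classical
  obtain ⟨haddr, h0r, h0l, hnegr, hnegl, hsubr, hsubl⟩ := UnitaryTwoOdd.herm_right hadd hsymm
  obtain ⟨C, hC, hBC⟩ := hadj B hB
  have hB0 : B ≠ 0 := fun h => by rw [h, LinearMap.range_zero, finrank_bot] at hsumij; omega
  have hιιv : ∀ v, ι (ι v) = v := fun v => by rw [← Module.End.mul_apply, hιι, Module.End.one_apply]
  have hsum : ∀ X ∈ 𝔊, Θ * X = X → X * Θ = -X → X * ι = ι * X → X ≠ 0 →
      Module.finrank ℂ (Up.map X) + Module.finrank ℂ (Um.map X) = Module.finrank ℂ (LinearMap.range B) := by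
    intro X hX hΘX hXΘ hXc hX0
    obtain ⟨h4, h6⟩ := hprof X hX hΘX hXΘ hXc hX0
    rw [h4, h6, hsumij]
  have hij : ∀ X ∈ 𝔊, Θ * X = X → X * Θ = -X → X * ι = ι * X → X ≠ 0 →
      Module.finrank ℂ (Up.map X) < Module.finrank ℂ (Um.map X) := by
    intro X hX hΘX hXΘ hXc hX0
    obtain ⟨h4, h6⟩ := hprof X hX hΘX hXΘ hXc hX0
    rw [h4, h6]; exact hij
  -- the subspace `𝔷` of raising elements of `𝔊` commuting with `ι`
  set Zs : Submodule ℂ (Module.End ℂ W) :=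
    { carrier := {X | X ∈ 𝔊 ∧ Θ * X = X ∧ X * Θ = -X ∧ X * ι = ι * X}
      zero_mem' := ⟨Submodule.zero_mem _, by rw [mul_zero], by rw [zero_mul, neg_zero], by rw [zero_mul, mul_zero]⟩
      add_mem' := fun {X Y} hX hY => ⟨Submodule.add_mem _ hX.1 hY.1, by rw [mul_add, hX.2.1, hY.2.1],
        by rw [add_mul, hX.2.2.1, hY.2.2.1, neg_add], by rw [add_mul, mul_add, hX.2.2.2, hY.2.2.2]⟩
      smul_mem' := fun c {X} hX => ⟨Submodule.smul_mem _ c hX.1, by rw [mul_smul_comm, hX.2.1],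
        by rw [smul_mul_assoc, hX.2.2.1, smul_neg], by rw [smul_mul_assoc, mul_smul_comm, hX.2.2.2]⟩ }
    with hZsdef
  have hmemZs : ∀ X, X ∈ Zs ↔ X ∈ 𝔊 ∧ Θ * X = X ∧ X * Θ = -X ∧ X * ι = ι * X := fun X => Iff.rfl
  -- the slot maps `Y ↦ Y X† B + B X† Y`
  let slot : Module.End ℂ W → (Module.End ℂ W →ₗ[ℂ] Module.End ℂ W) := fun Xa =>
    LinearMap.mulRight ℂ (Xa * B) + LinearMap.mulLeft ℂ (B * Xa)
  have hslot : ∀ Xa Y : Module.End ℂ W, slot Xa Y = Y * Xa * B + B * Xa * Y := fun Xa Y => by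
    simp only [slot, LinearMap.add_apply, LinearMap.mulRight_apply, LinearMap.mulLeft_apply, mul_assoc]
  -- wrappers of the packages
  have hmem : ∀ X Xa : Module.End ℂ W, X ∈ Zs → X ≠ 0 → Xa ∈ 𝔊 → (∀ x y, s (X x) y = s x (Xa y)) →
      ∃ μ : ℂ, μ ≠ 0 ∧ starRingEnd ℂ μ = μ ∧ X * Xa * B + B * Xa * X = μ • B ∧ X * Xa * X = μ • X ∧
        (∀ p ∈ Up.map X, X (Xa p) = μ • p) ∧ (∀ p ∈ Um.map X, X (Xa p) = μ • p) ∧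
        (∀ p ∈ Um.map X, ∃ q ∈ QU, X q = 0 ∧ B q = p) := by
    intro X Xa hXZ hX0 hXa hXXa
    obtain ⟨hX, hΘX, hXΘ, hXc⟩ := (hmemZs X).1 hXZ
    exact UnitaryProfileFourSix.member hbr hΘΘ hP hQ hadd hsmul hsymm hPQ hdefP hdefQ hadj hΘB hBΘ hB0 hmin hC hBC hιι
      hιΘ hιs hUm hUp hPM hQM hQU hfinQU' hX hΘX hXΘ hXc hX0 hXa hXXa (hsum X hX hΘX hXΘ hXc hX0)
      (hij X hX hΘX hXΘ hXc hX0)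
  have hpair : ∀ X Xa Y Ya : Module.End ℂ W, ∀ μ : ℂ, X ∈ Zs → X ≠ 0 → Xa ∈ 𝔊 →
      (∀ x y, s (X x) y = s x (Xa y)) → Y ∈ Zs → Y ≠ 0 → Ya ∈ 𝔊 → (∀ x y, s (Y x) y = s x (Ya y)) →
      starRingEnd ℂ μ = μ → X * Xa * B + B * Xa * X = μ • B → X * Xa * X = μ • X →
      Y * Xa * B + B * Xa * Y = 0 →
      X * Xa * Y + Y * Xa * X = μ • Y ∧ Ya * X * Xa + Xa * X * Ya = μ • Ya := by
    intro X Xa Y Ya μ hXZ hX0 hXa hXXa hYZ hY0 hYa hYYa hμreal hμB hXXX horth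
    obtain ⟨hX, hΘX, hXΘ, hXc⟩ := (hmemZs X).1 hXZ
    obtain ⟨hY, hΘY, hYΘ, hYc⟩ := (hmemZs Y).1 hYZ
    obtain ⟨hS, hΘS, hSΘ, hSc⟩ := (hmemZs (X + Y)).1 (Zs.add_mem hXZ hYZ)
    have hS0 : X + Y ≠ 0 := by
      intro h0
      have hYX : Y = -X := eq_neg_of_add_eq_zero_right h0
      have h1 : Y * Xa * B + B * Xa * Y = -(μ • B) := by rw [hYX, neg_mul, neg_mul, mul_neg, ← neg_add, hμB]
      rw [horth, eq_comm, neg_eq_zero, smul_eq_zero] at h1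
      rcases h1 with h1 | h1
      · -- `μ = 0` contradicts `X X† X = μ X`, `X ≠ 0`? use the member package instead: `μ ≠ 0`
        obtain ⟨μ', hμ'0, -, hμ'B, -, -, -, -⟩ := hmem X Xa hXZ hX0 hXa hXXa
        rw [h1, zero_smul] at hμB
        rw [hμB, eq_comm, smul_eq_zero] at hμ'B
        rcases hμ'B with h | h
        · exact hμ'0 h
        · exact hB0 h
      · exact hB0 h1
    exact UnitaryProfileFourSix.pair hbr hΘΘ hP hQ hadd hsmul hsymm hPQ hdefP hdefQ hadj hΘB hBΘ hB0 hmin hC hBC hιι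
      hιΘ hιs hUm hUp hPM hQM hQU hfinQU' hX hΘX hXΘ hXc hXXa hY hΘY hYΘ hYc hYa hYYa (hsum Y hY hΘY hYΘ hYc hY0)
      (hij Y hY hΘY hYΘ hYc hY0) (hsum _ hS hΘS hSΘ hSc hS0) (hij _ hS hΘS hSΘ hSc hS0) hXa hμreal hμB hXXX horth
  have hosymm : ∀ X Xa Y Ya : Module.End ℂ W, X ∈ Zs → X ≠ 0 → Xa ∈ 𝔊 → (∀ x y, s (X x) y = s x (Xa y)) →
      Y ∈ Zs → Y ≠ 0 → Ya ∈ 𝔊 → (∀ x y, s (Y x) y = s x (Ya y)) →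
      Y * Xa * B + B * Xa * Y = 0 → X * Ya * B + B * Ya * X = 0 := by
    intro X Xa Y Ya hXZ hX0 hXa hXXa hYZ hY0 hYa hYYa horth
    obtain ⟨hX, hΘX, hXΘ, hXc⟩ := (hmemZs X).1 hXZ
    obtain ⟨hY, hΘY, hYΘ, hYc⟩ := (hmemZs Y).1 hYZ
    exact UnitaryProfileFourSix.orth_symm hbr hΘΘ hP hQ hadd hsymm hPQ hdefP hdefQ hadj hΘB hBΘ hB0 hmin hC hBC hιι
      hιΘ hιs hUm hUp hPM hQM hQU hfinQU' hX hΘX hXΘ hXc hX0 hXa hXXa hY hΘY hYΘ hYc hYa hYYa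
      (hsum X hX hΘX hXΘ hXc hX0) (hij X hX hΘX hXΘ hXc hX0) (hsum Y hY hΘY hYΘ hYc hY0)
      (hij Y hY hΘY hYΘ hYc hY0) horth
  -- basic geometry of the pieces
  have hBinj : ∀ a ∈ QU, B a = 0 → a = 0 := by
    intro a ha hBa
    obtain ⟨hιa, hΘa⟩ := (hQU a).1 ha
    have hmem' : a ∈ Q ⊓ LinearMap.ker B := Submodule.mem_inf.2 ⟨(hQ a).2 hΘa, LinearMap.mem_ker.2 hBa⟩
    obtain ⟨hιa', -⟩ := (hQM a).1 hmem'
    rw [hιa] at hιa'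
    have h2 : (2 : ℂ) • a = 0 := by rw [two_smul]; nth_rewrite 2 [hιa']; rw [add_neg_cancel]
    exact (smul_eq_zero.1 h2).resolve_left two_ne_zero
  have hmapUpPU : ∀ Y : Module.End ℂ W, Θ * Y = Y → Y * ι = ι * Y → Up.map Y ≤ PU := by
    intro Y hΘY hYc
    rintro _ ⟨u, hu, rfl⟩
    exact (hPU _).2 ⟨by rw [← Module.End.mul_apply, ← hYc, Module.End.mul_apply, (hUp u).1 hu],
      by rw [← Module.End.mul_apply, hΘY]⟩
  -- THE INDUCTION over orthogonal families, on the dimension of the orthogonal complement in `𝔷`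
  suffices key : ∀ (d t : ℕ) (X Xa : Fin t → Module.End ℂ W),
      (∀ a, X a ∈ Zs ∧ X a ≠ 0 ∧ Xa a ∈ 𝔊 ∧ ∀ x y, s (X a x) y = s x (Xa a y)) →
      (∀ a b, a ≠ b → X b * Xa a * B + B * Xa a * X b = 0) →
      Module.finrank ℂ PU ≤ Module.finrank ℂ ↥(PU ⊓ ⨅ a, Up.map (X a)) + t * c →
      (Module.finrank ℂ ↥(QU ⊓ ⨅ a, LinearMap.ker (X a)) ≤ g t ∧
        Module.finrank ℂ ↥(Q ⊓ LinearMap.ker B) ≤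
          Module.finrank ℂ ↥((Q ⊓ LinearMap.ker B) ⊓ ⨅ a, LinearMap.ker (X a)) + G t) →
      Module.finrank ℂ ↥(Zs ⊓ ⨅ a, LinearMap.ker (slot (Xa a))) = d → False by
    refine key _ 0 Fin.elim0 Fin.elim0 (fun a => a.elim0) (fun a => a.elim0) ?_ ?_ rfl
    · rw [iInf_of_empty, inf_top_eq]; omega
    · rw [iInf_of_empty, inf_top_eq, inf_top_eq, hG0]
      omega
  intro d
  refine Nat.strong_induction_on d ?_
  intro d ih t X Xa hfam horth hH hinv hd
  set N : Submodule ℂ W := QU ⊓ ⨅ a, LinearMap.ker (X a) with hN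
  set K : Submodule ℂ W := (Q ⊓ LinearMap.ker B) ⊓ ⨅ a, LinearMap.ker (X a) with hK
  set Hc : Submodule ℂ W := PU ⊓ ⨅ a, Up.map (X a) with hHc
  set Zo : Submodule ℂ (Module.End ℂ W) := Zs ⊓ ⨅ a, LinearMap.ker (slot (Xa a)) with hZo
  have hm2 : 1 ≤ Module.finrank ℂ K := by
    have h := hGlt t
    omega
  -- member constants of the family
  have hμex : ∀ a, ∃ μ : ℂ, μ ≠ 0 ∧ starRingEnd ℂ μ = μ ∧ X a * Xa a * B + B * Xa a * X a = μ • B ∧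
      X a * Xa a * X a = μ • X a ∧ (∀ p ∈ Up.map (X a), X a (Xa a p) = μ • p) ∧
      (∀ p ∈ Um.map (X a), X a (Xa a p) = μ • p) ∧ (∀ p ∈ Um.map (X a), ∃ q ∈ QU, X a q = 0 ∧ B q = p) :=
    fun a => hmem (X a) (Xa a) (hfam a).1 (hfam a).2.1 (hfam a).2.2.1 (hfam a).2.2.2
  choose μ hμ0 hμreal hμB hXXX hpX hmX hBX using hμex
  by_cases hterm : ∀ Y ∈ Zo, Y = 0
  · -- TERMINAL CASE: `𝔷 = span (X a)`, so `𝔷` kills `K`, so `K = 0` — against `dim K ≥ 2`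
    have hKbot : K = ⊥ := by
      refine (Submodule.eq_bot_iff _).2 fun k hk => ?_
      obtain ⟨hkQ, hkX⟩ := Submodule.mem_inf.1 hk
      refine hjoint k hkQ fun Y hY hΘY hYΘ hYc => ?_
      have hYZ : Y ∈ Zs := ⟨hY, hΘY, hYΘ, hYc⟩
      obtain ⟨Ya, hYa, hYYa⟩ := hadj Y hY
      have hcex : ∀ a, ∃ c : ℂ, Y * Xa a * B + B * Xa a * Y = c • B := by
        intro a
        obtain ⟨hXa1, hΘXa, hXaΘ, hXac⟩ := (hmemZs (X a)).1 (hfam a).1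
        exact UnitaryLeviSetup.slot_identity hbr hΘΘ hP hQ hadd hsymm hPQ hdefP hdefQ hadj hΘB hBΘ hB0 hmin hC hBC hιι
          hιΘ hιs hPM hQM hQU hfinQU' hXa1 hΘXa hXaΘ hXac (hfam a).2.2.2 hΘY hYΘ hYc hYa hYYa
      choose c hc using hcex
      set Y' : Module.End ℂ W := Y - ∑ a, (c a / μ a) • X a with hY'
      have hY'Z : Y' ∈ Zs :=
        Zs.sub_mem hYZ (Zs.sum_mem fun a _ => Zs.smul_mem _ (hfam a).1)
      have hY'orth : ∀ b, slot (Xa b) Y' = 0 := by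
        intro b
        rw [hY', map_sub, map_sum, hslot, hc b, Finset.sum_eq_single b, map_smul, hslot, hμB b, smul_smul,
          div_mul_cancel₀ _ (hμ0 b), sub_self]
        · intro a _ hab
          rw [map_smul, hslot, horth b a (Ne.symm hab), smul_zero]
        · intro h; exact absurd (Finset.mem_univ b) h
      have hY'0 : Y' = 0 := hterm Y' (Submodule.mem_inf.2 ⟨hY'Z, (Submodule.mem_iInf _).2 fun b =>
        LinearMap.mem_ker.2 (hY'orth b)⟩)
      have hYsum : Y = ∑ a, (c a / μ a) • X a := sub_eq_zero.1 (by rw [← hY']; exact hY'0)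
      rw [hYsum, LinearMap.sum_apply]
      refine Finset.sum_eq_zero fun a _ => ?_
      rw [LinearMap.smul_apply, LinearMap.mem_ker.1 ((Submodule.mem_iInf _).1 hkX a), smul_zero]
    rw [hKbot, finrank_bot] at hm2
    omega
  · -- INDUCTIVE CASE: extend the family by a non-zero `Y ∈ 𝔷` orthogonal to it
    push Not at hterm
    obtain ⟨Y, hYZo, hY0⟩ := hterm
    obtain ⟨hYZ, hYorth⟩ := Submodule.mem_inf.1 hYZo
    have hYo : ∀ a, Y * Xa a * B + B * Xa a * Y = 0 := fun a => by
      have h := (Submodule.mem_iInf _).1 hYorth a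
      rw [LinearMap.mem_ker, hslot] at h
      exact h
    obtain ⟨hY, hΘY, hYΘ, hYc⟩ := (hmemZs Y).1 hYZ
    obtain ⟨Ya, hYa, hYYa⟩ := hadj Y hY
    obtain ⟨hΘYa, hYaΘ, hYac, hYaY⟩ :=
      UnitaryLeviSetup.adj_raise hΘΘ hP hQ hadd hsymm hPQ hdefP hdefQ hιs hΘY hYΘ hYc hYYa
    obtain ⟨μY, hμY0, hμYreal, hμYB, hYYY, hpY, hmY, hBY⟩ := hmem Y Ya hYZ hY0 hYa hYYa
    have hYij := hprof Y hY hΘY hYΘ hYc hY0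
    -- (II) and (II)† for the pairs `(X a, Y)`
    have hII : ∀ a, X a * Xa a * Y + Y * Xa a * X a = μ a • Y ∧ Ya * X a * Xa a + Xa a * X a * Ya = μ a • Ya :=
      fun a => hpair (X a) (Xa a) Y Ya (μ a) (hfam a).1 (hfam a).2.1 (hfam a).2.2.1 (hfam a).2.2.2 hYZ hY0 hYa hYYa
        (hμreal a) (hμB a) (hXXX a) (hYo a)
    -- the new family
    set X' : Fin (t + 1) → Module.End ℂ W := Fin.snoc X Y with hX'
    set Xa' : Fin (t + 1) → Module.End ℂ W := Fin.snoc Xa Ya with hXa'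
    have hfam' : ∀ a, X' a ∈ Zs ∧ X' a ≠ 0 ∧ Xa' a ∈ 𝔊 ∧ ∀ x y, s (X' a x) y = s x (Xa' a y) := by
      intro a
      refine Fin.lastCases ?_ (fun a => ?_) a
      · simp only [hX', hXa', Fin.snoc_last]; exact ⟨hYZ, hY0, hYa, hYYa⟩
      · simp only [hX', hXa', Fin.snoc_castSucc]; exact hfam a
    have horth' : ∀ a b, a ≠ b → X' b * Xa' a * B + B * Xa' a * X' b = 0 := by
      intro a b hab
      induction a using Fin.lastCases with
      | last =>
        induction b using Fin.lastCases with
        | last => exact absurd rfl hab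
        | cast b =>
          simp only [hX', hXa', Fin.snoc_last, Fin.snoc_castSucc]
          exact hosymm (X b) (Xa b) Y Ya (hfam b).1 (hfam b).2.1 (hfam b).2.2.1 (hfam b).2.2.2 hYZ hY0 hYa hYYa (hYo b)
      | cast a =>
        induction b using Fin.lastCases with
        | last => simp only [hX', hXa', Fin.snoc_last, Fin.snoc_castSucc]; exact hYo a
        | cast b =>
          simp only [hX', hXa', Fin.snoc_castSucc]
          exact horth a b fun h => hab (by rw [h])
    -- the new pieces
    have hN' : (QU ⊓ ⨅ a, LinearMap.ker (X' a)) = N ⊓ LinearMap.ker Y := by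
      rw [hX', UnitaryOrthogonalChain.iInf_comp_snoc (fun Z : Module.End ℂ W => LinearMap.ker Z), hN, inf_assoc]
    have hK' : ((Q ⊓ LinearMap.ker B) ⊓ ⨅ a, LinearMap.ker (X' a)) = K ⊓ LinearMap.ker Y := by
      rw [hX', UnitaryOrthogonalChain.iInf_comp_snoc (fun Z : Module.End ℂ W => LinearMap.ker Z), hK]
      simp only [inf_assoc]
    have hHc' : (PU ⊓ ⨅ a, Up.map (X' a)) = Hc ⊓ Up.map Y := by
      rw [hX', UnitaryOrthogonalChain.iInf_comp_snoc (fun Z : Module.End ℂ W => Up.map Z), hHc, inf_assoc]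
    have hZo' : (Zs ⊓ ⨅ a, LinearMap.ker (slot (Xa' a))) = Zo ⊓ LinearMap.ker (slot Ya) := by
      rw [hXa', UnitaryOrthogonalChain.iInf_comp_snoc (fun Z : Module.End ℂ W => LinearMap.ker (slot Z)), hZo, inf_assoc]
    -- (R1) rank–nullity for `Y` on `N` and on `K`
    have hR1 := UnitaryProfileFourSix.finrank_inf_ker_add_finrank_map N Y
    have hR1K := UnitaryProfileFourSix.finrank_inf_ker_add_finrank_map K Y
    -- (R2) `Hc ∩ Y(U⁺) ⊆ Y(N)`
    have hR2 : Hc ⊓ Up.map Y ≤ N.map Y := by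
      intro p hp
      obtain ⟨hpHc, hpUY⟩ := Submodule.mem_inf.1 hp
      obtain ⟨hpPU, hpXcap⟩ := Submodule.mem_inf.1 hpHc
      obtain ⟨hιp, -⟩ := (hPU p).1 hpPU
      refine ⟨μY⁻¹ • Ya p, Submodule.mem_inf.2 ⟨Submodule.smul_mem _ _ ((hQU _).2 ⟨?_, ?_⟩),
        (Submodule.mem_iInf _).2 fun a => LinearMap.mem_ker.2 ?_⟩, ?_⟩
      · rw [← Module.End.mul_apply, ← hYac, Module.End.mul_apply, hιp]
      · rw [← Module.End.mul_apply, hΘYa, LinearMap.neg_apply]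
      · -- `X a (Y† p) = 0` from (II)† and `X a X a† p = μ a p`
        rw [map_smul]
        have hpa : p ∈ Up.map (X a) := (Submodule.mem_iInf _).1 hpXcap a
        have h := congrArg (fun T : Module.End ℂ W => T p) (hII a).2
        simp only [LinearMap.add_apply, Module.End.mul_apply, LinearMap.smul_apply] at h
        rw [hpX a p hpa, map_smul, add_eq_left] at h
        obtain ⟨-, hΘXa1, -, -⟩ := (hmemZs (X a)).1 (hfam a).1
        have hmemP : X a (Ya p) ∈ P := (hP _).2 (by rw [← Module.End.mul_apply, hΘXa1])
        have h0 : X a (Ya p) = 0 := hdefP _ hmemP (by rw [(hfam a).2.2.2, h, h0r])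
        rw [h0, smul_zero]
      · rw [map_smul, hpY p hpUY, smul_smul, inv_mul_cancel₀ hμY0, one_smul]
    -- (R3) `dim (Hc ∩ Y(U⁺)) + 1 ≥ dim Hc` (`Y(U⁺)` is a hyperplane of `P ∩ U⁺`)
    have hR3 : Module.finrank ℂ Hc ≤ Module.finrank ℂ ↥(Hc ⊓ Up.map Y) + c := by
      have h1 := Submodule.finrank_sup_add_finrank_inf_eq Hc (Up.map Y)
      have h2 : Module.finrank ℂ ↥(Hc ⊔ Up.map Y) ≤ Module.finrank ℂ PU :=
        Submodule.finrank_mono (sup_le inf_le_left (hmapUpPU Y hΘY hYc))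
      rw [hYij.1] at h1
      omega
    -- (R4) `Y(K) ⊆ B(N ∩ ker Y)`
    have hR4 : Module.finrank ℂ (K.map Y) ≤ Module.finrank ℂ ↥(N ⊓ LinearMap.ker Y) := by
      have hle : K.map Y ≤ (N ⊓ LinearMap.ker Y).map B := by
        rintro _ ⟨k, hk, rfl⟩
        obtain ⟨hkQ, hkX⟩ := Submodule.mem_inf.1 hk
        obtain ⟨hιk, -⟩ := (hQM k).1 hkQ
        have hkUm : k ∈ Um := (hUm k).2 hιk
        obtain ⟨q, hqQU, hYq, hBq⟩ := hBY (Y k) (Submodule.mem_map_of_mem hkUm)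
        refine ⟨q, Submodule.mem_inf.2 ⟨Submodule.mem_inf.2 ⟨hqQU, (Submodule.mem_iInf _).2 fun a =>
          LinearMap.mem_ker.2 ?_⟩, LinearMap.mem_ker.2 hYq⟩, hBq⟩
        -- `Y k ∈ X a(U⁻)` by (II), so `Y k = B q_a` with `X a q_a = 0`, and `q_a = q`
        have hXak : X a k = 0 := LinearMap.mem_ker.1 ((Submodule.mem_iInf _).1 hkX a)
        have h := congrArg (fun T : Module.End ℂ W => T k) (hII a).1
        simp only [LinearMap.add_apply, Module.End.mul_apply, LinearMap.smul_apply, hXak, map_zero, add_zero] at h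
        have hYkUm : Y k ∈ Um :=
          (hUm _).2 (by rw [← Module.End.mul_apply, ← hYc, Module.End.mul_apply, hιk, map_neg])
        obtain ⟨hXa1, hΘXa1, hXaΘ1, hXac1⟩ := (hmemZs (X a)).1 (hfam a).1
        obtain ⟨-, -, hXaac, -⟩ :=
          UnitaryLeviSetup.adj_raise hΘΘ hP hQ hadd hsymm hPQ hdefP hdefQ hιs hΘXa1 hXaΘ1 hXac1 (hfam a).2.2.2
        have hmemUm : Xa a (Y k) ∈ Um :=
          (hUm _).2 (by rw [← Module.End.mul_apply, ← hXaac, Module.End.mul_apply, (hUm _).1 hYkUm, map_neg])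
        have hYk : Y k ∈ Um.map (X a) := by
          have e : Y k = (μ a)⁻¹ • X a (Xa a (Y k)) := by rw [h, smul_smul, inv_mul_cancel₀ (hμ0 a), one_smul]
          rw [e]; exact Submodule.smul_mem _ _ (Submodule.mem_map_of_mem hmemUm)
        obtain ⟨qa, hqaQU, hXqa, hBqa⟩ := hBX a (Y k) hYk
        have hqq : qa = q := by
          have h0 : B (qa - q) = 0 := by rw [map_sub, hBqa, hBq, sub_self]
          exact sub_eq_zero.1 (hBinj _ (Submodule.sub_mem _ hqaQU hqQU) h0)
        rw [← hqq]; exact hXqa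
      exact (Submodule.finrank_mono hle).trans (Submodule.finrank_map_le _ _)
    -- (R5) the orthogonal complement shrinks strictly
    have hlt : Module.finrank ℂ ↥(Zo ⊓ LinearMap.ker (slot Ya)) < d := by
      rw [← hd]
      refine Submodule.finrank_lt_finrank_of_lt (lt_of_le_of_ne inf_le_left fun heq => ?_)
      have hYmem : Y ∈ Zo ⊓ LinearMap.ker (slot Ya) := by rw [heq]; exact hYZo
      have h := (Submodule.mem_inf.1 hYmem).2
      rw [LinearMap.mem_ker, hslot, hμYB] at h
      rcases smul_eq_zero.1 h with h | h
      · exact hμY0 h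
      · exact hB0 h
    -- apply the induction hypothesis to the extended family
    have h2' := Submodule.finrank_mono hR2
    have hd' : Module.finrank ℂ ↥(Zs ⊓ ⨅ a, LinearMap.ker (slot (Xa' a))) =
        Module.finrank ℂ ↥(Zo ⊓ LinearMap.ker (slot Ya)) := by
      rw [hZo']
    have hmulc : (t + 1) * c = t * c + c := by ring
    have hgt := hg t
    have hGt := hG t
    refine ih _ hlt (t + 1) X' Xa' hfam' horth' ?_ ?_ hd'
    · rw [hHc']; omega
    · rw [hN', hK']
      rw [hHc'] at *
      constructor
      · omega
      · omega

end HodgeStructure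

end Literature.AlgebraicGeometry.Motives

end
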